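import Mathlib
import Literature.NumberTheory.Transcendental.ZagierDilogarithmConjecture
import Literature.NumberTheory.Transcendental.BlochWignerDilogarithm
import Literature.NumberTheory.Transcendental.BlochWignerDilogarithmProofs
import Summits.KontsevichZagierPeriods.KontsevichZagierPeriods.Theorems.HyperbolicBlochZagierDilogarithmConjectureStubKummerDescent
import HarnessLib

/-!
# Self-similar Galois twists propagate the vanishing of the Bloch–Wigner sum

Stub `stub_selfSimilar` of the line `kummer-clausen-linearisation` (reshape c2, "Galois descent")
for the crux `ZagierDilogarithmConjecture` (stmt-KontsevichZagierPeriods-10550, route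
`HyperbolicBloch`).

Write `D := blochWignerDilog`, `C := AddSubgroup.closure dilogRelators ⊆ ℤ[ℂ]`
(`FreeAbelianGroup ℂ`) and `ℚ̄ := algebraicClosure ℚ ℂ`. For a combination `β = Σ nᵢ[zᵢ]` put
`ξ := Σ nᵢ([zᵢ] − [z̄ᵢ])`, and for a `ℚ`-embedding `σ : ℚ̄ → ℂ` together with lifts
`wᵢ, w'ᵢ ∈ ℚ̄` of `zᵢ, z̄ᵢ` put `σ_*ξ := Σ nᵢ([σwᵢ] − [σw'ᵢ])`.

**Self-similarity ⇒ Galois propagation** (`stub_selfSimilar`): if for every `σ` (and lifts) there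
are integers `a ≠ 0`, `b` with `a•σ_*ξ − b•ξ ∈ C`, then `Σ nᵢ D(zᵢ) = 0` implies
`Σ nᵢ (D(σwᵢ) − D(σw'ᵢ)) = 0` for every `σ`.

Proof: apply the value homomorphism `L := FreeAbelianGroup.lift D : ℤ[ℂ] →+ ℝ`. It kills `C`
(`lift_eq_zero_of_mem_closure`: Neumann's five-term relation, `D(z̄) = −D(z)`, `D|_ℝ = 0`), so
`a·L(σ_*ξ) = b·L(ξ)`; and `L(ξ) = Σ nᵢ (D(zᵢ) − D(z̄ᵢ)) = 2 Σ nᵢ D(zᵢ) = 0` by `D(z̄) = −D(z)`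
(`blochWignerDilog_conj'`). Since `a ≠ 0` in `ℝ`, `L(σ_*ξ) = Σ nᵢ (D(σwᵢ) − D(σw'ᵢ)) = 0`.

Sources: Neumann 1998 §2 (relators and `D(z̄) = −D(z)`); Zagier 2007 Ch. I §§3–4.
Not here: which combinations ARE self-similar (one-complex-place fields, `τ`-symmetric
biquadratic combinations) — those are separate stubs of the line.
-/

noncomputable section

open scoped BigOperators ComplexConjugate
open Literature.NumberTheory.Transcendental

namespace Summit.KontsevichZagierPeriods.HyperbolicBloch.ZagierDilogarithmGaloisDescent

open Summit.KontsevichZagierPeriods.HyperbolicBloch.ZagierDilogarithm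
  (lift_eq_zero_of_mem_closure)

/-- The value `L(ξ)` of `ξ = Σ nᵢ([zᵢ] − [z̄ᵢ])` under `L = FreeAbelianGroup.lift D` is
`2 Σ nᵢ D(zᵢ)`, by `D(z̄) = −D(z)`. [folklore] -/
theorem lift_sum_zsmul_of_sub_of_conj {ι : Type*} [Fintype ι] (z : ι → ℂ) (n : ι → ℤ) :
    FreeAbelianGroup.lift blochWignerDilog
        (∑ i, n i • (FreeAbelianGroup.of (z i) - FreeAbelianGroup.of (conj (z i)))) =
      2 * ∑ i, (n i : ℝ) * blochWignerDilog (z i) := by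
  simp only [map_sum, map_zsmul, map_sub, FreeAbelianGroup.lift_apply_of, blochWignerDilog_conj']
  simp only [zsmul_eq_mul]
  rw [Finset.mul_sum]
  refine Finset.sum_congr rfl ?_
  intro i _
  ring

/-- The value `L(Σ nᵢ([uᵢ] − [vᵢ]))` under `L = FreeAbelianGroup.lift D` is `Σ nᵢ (D(uᵢ) − D(vᵢ))`.
[folklore] -/
theorem lift_sum_zsmul_of_sub_of {ι : Type*} [Fintype ι] (u v : ι → ℂ) (n : ι → ℤ) :
    FreeAbelianGroup.lift blochWignerDilog
        (∑ i, n i • (FreeAbelianGroup.of (u i) - FreeAbelianGroup.of (v i))) =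
      ∑ i, (n i : ℝ) * (blochWignerDilog (u i) - blochWignerDilog (v i)) := by
  simp only [map_sum, map_zsmul, map_sub, FreeAbelianGroup.lift_apply_of]
  simp only [zsmul_eq_mul]

/-- **Self-similarity ⇒ Galois propagation.** Let `zᵢ ∈ ℂ`, `nᵢ ∈ ℤ`, and suppose that for every
`ℚ`-embedding `σ : ℚ̄ → ℂ` (`ℚ̄ = algebraicClosure ℚ ℂ`) and all lifts `wᵢ, w'ᵢ ∈ ℚ̄` of `zᵢ, z̄ᵢ`
there are `a ≠ 0`, `b ∈ ℤ` with `a•σ_*ξ − b•ξ ∈ ⟨dilogRelators⟩`, where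
`ξ = Σ nᵢ([zᵢ] − [z̄ᵢ])` and `σ_*ξ = Σ nᵢ([σwᵢ] − [σw'ᵢ])`. If `Σ nᵢ D(zᵢ) = 0` then
`Σ nᵢ (D(σwᵢ) − D(σw'ᵢ)) = 0` for every such `σ, w, w'`: the value homomorphism
`[x] ↦ D(x)` kills the relator group, `D(ξ) = 2 Σ nᵢ D(zᵢ) = 0`, and `a ≠ 0`. [folklore] -/
theorem stub_selfSimilar :
    ∀ (k : ℕ) (z : Fin k → ℂ) (n : Fin k → ℤ),
      (∀ (σ : ↥(algebraicClosure ℚ ℂ) →ₐ[ℚ] ℂ) (w w' : Fin k → ↥(algebraicClosure ℚ ℂ)),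
          (∀ i, (w i : ℂ) = z i) → (∀ i, (w' i : ℂ) = conj (z i)) →
          ∃ a b : ℤ, a ≠ 0 ∧
            a • (∑ i, n i • (FreeAbelianGroup.of (σ (w i)) - FreeAbelianGroup.of (σ (w' i)))) -
              b • (∑ i, n i • (FreeAbelianGroup.of (z i) - FreeAbelianGroup.of (conj (z i)))) ∈
                AddSubgroup.closure dilogRelators) →
      ∑ i, (n i : ℝ) * blochWignerDilog (z i) = 0 →
        ∀ (σ : ↥(algebraicClosure ℚ ℂ) →ₐ[ℚ] ℂ) (w w' : Fin k → ↥(algebraicClosure ℚ ℂ)),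
          (∀ i, (w i : ℂ) = z i) → (∀ i, (w' i : ℂ) = conj (z i)) →
          ∑ i, (n i : ℝ) * (blochWignerDilog (σ (w i)) - blochWignerDilog (σ (w' i))) = 0 := by
  intro k z n hself hsum σ w w' hw hw'
  obtain ⟨a, b, ha, hmem⟩ := hself σ w w' hw hw'
  have hL := lift_eq_zero_of_mem_closure hmem
  rw [map_sub, map_zsmul, map_zsmul, lift_sum_zsmul_of_sub_of_conj, lift_sum_zsmul_of_sub_of,
    hsum, mul_zero, smul_zero, sub_zero, zsmul_eq_mul, mul_eq_zero] at hL
  exact hL.resolve_left (Int.cast_ne_zero.mpr ha)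

end Summit.KontsevichZagierPeriods.HyperbolicBloch.ZagierDilogarithmGaloisDescent

end
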